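import Summits.Langlands.Langlands.Theses.DyadicOddResidue
import Summits.Langlands.Langlands.Theorems.SectorComplement.Negative.DyadicOddResidueSectorComplementPosition

/-!
# F3 / BC5 WITNESS for the ladder line `OddPrimesAllWt` on `DyadicOddResidue.Assembly` (crux stmt-Langlands-18746)

Self-contained: §1 is the line file `Lines/OddPrimesAllWt_DyadicOddResidue.lean` §1 VERBATIM (same namespace, same
bodies of `OddReciprocityQ`, `regularWt`, `oddPrimesAllWt`, `allWt`, `Rung`, `SectorComplementAllWt`); §2 proves, with
NO sorry, that the graded family SPECIALISES TO THE PROVED FLOOR: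
* `rung_regularWt : Rung regularWt` — the θ₀ member (weight clause = `Nodup`, i.e. the parent target
  `OddRegularReciprocityQ` verbatim: `oddReciprocityQ_regularWt_iff`) follows from the four cells by the trichotomy at
  `ℓ` (`ℓ ≠ 2` / `ℓ = 2` residually reducible / dihedral / non-solvable) — the `hT` step of the route's `closes`;
* `rung_regularWt_of_landed` — the same from the LANDED theorem
  `Summit.Langlands.Langlands.Theorems.dyadicOddResidue_not_target_iff_sectors` (Theorems/SectorComplement/Negative/…);
* `example : Rung regularWt := by simpa [Rung] using rung_regularWt_of_landed` (F3 line).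
The next rung `Rung oddPrimesAllWt` (θ₁, `stub_rung` of the line) is NOT proved here (same-rung guard: `Rung regularWt →
Rung oddPrimesAllWt` is weight-one Fontaine–Mazur at odd `ℓ`, not closed by automation — bc/Rung_probe.lean).
Witness regime: odd, Hodge–Tate-REGULAR `GL₂/ℚ`, clause (B) a.e. — S (`Langlands`: all `F`, all `n`, both directions,
all places) is NOT known there (nor is its `(ℚ, GL₂)` cell: (A) for algebraic Maass forms, even (B) are open).
-/

noncomputable section

set_option linter.dupNamespace false

namespace Summit.Langlands.Langlands.Cruxes.Assembly.OddPrimesAllWt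

open scoped BigOperators Topology Manifold Classical MeasureTheory ProbabilityTheory Matrix InnerProductSpace ComplexConjugate ContinuousMap
open Filter Set Function TopologicalSpace MeasureTheory
open Summit.Langlands.Langlands.Theses.DyadicOddResidue

/-! ## The graded family (rung_decl) -/

/-- The parent target `OddRegularReciprocityQ` with its weight clause `HT_τ(…).Nodup` replaced by the parameter
`adm ℓ HT_τ(…)`; everything else VERBATIM. -/
def OddReciprocityQ (adm : ℕ → Multiset ℤ → Prop) : Prop :=
  ∀ (ℓ : ℕ) [Fact ℓ.Prime] (ρ : Literature.NumberTheory.GaloisRepresentations.FramedGaloisRep ℚ (PadicAlgCl ℓ) 2), ρ.toGaloisRep.IsIrreducible → ρ.IsOdd → (∀ᶠ v : IsDedekindDomain.HeightOneSpectrum (NumberField.RingOfIntegers ℚ) in Filter.cofinite, ρ.IsUnramifiedAt v) → (∀ (v : IsDedekindDomain.HeightOneSpectrum (NumberField.RingOfIntegers ℚ)) (hv : ((ℓ : ℕ) : NumberField.RingOfIntegers ℚ) ∈ v.asIdeal), (Literature.NumberTheory.PAdicHodge.fontainePstAdicCompletion v ℓ hv).IsDeRhamFramed (ρ.toLocal v)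 ∧ ∀ τ : v.adicCompletion ℚ →+* PadicAlgCl ℓ, Continuous τ → adm ℓ (ρ.labelledHodgeTateWeightsAt v (Literature.NumberTheory.PAdicHodge.fontainePstAdicCompletion v ℓ hv).algebra (Literature.NumberTheory.PAdicHodge.fontainePstAdicCompletion v ℓ hv).𝔅 τ)) → ∀ (hcpt : Literature.NumberTheory.Automorphic.isCompact_glFiniteIntegralLevel 2 ℚ) (ι : PadicAlgCl ℓ ≃+* ℂ), ∃ π : Literature.NumberTheory.Automorphic.CuspidalAutomorphicRepData 2 ℚ hcpt, π.1.IsLAlgebraic ∧ ∀ᶠ v : IsDedekindDomain.HeightOneSpectrum (NumberField.RingOfIntegers ℚ) in Filter.cofinite, Summit.Langlands.SatakeFrobCompatibleAt ι π.1 ρ v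

/-- θ₀ (floor): multiplicity-free labelled Hodge–Tate weights at every `ℓ`. -/
def regularWt : ℕ → Multiset ℤ → Prop := fun _ m => m.Nodup

/-- θ₁ (next rung): no weight condition at odd `ℓ`; regular at `ℓ = 2`. -/
def oddPrimesAllWt : ℕ → Multiset ℤ → Prop := fun ℓ m => ℓ = 2 → m.Nodup

/-- θ₂ (top of the weight parameter): no weight condition. -/
def allWt : ℕ → Multiset ℤ → Prop := fun _ _ => True

/-- The rung in C's cell language (K1, K2 = the route's open cruxes; S1, S2 = its printed supports). -/
def Rung (adm : ℕ → Multiset ℤ → Prop) : Prop :=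
  DyadicEisensteinFM → DyadicDihedralFM → OddPrimesRegularFM → DyadicNonsolvableFM → OddReciprocityQ adm

/-- The junction one rung up: reciprocity for `GL_n` over number fields GRANTED clause (B), a.e. form, on the whole
odd sector of `GL₂/ℚ` (all weights, all `ℓ`).  Frame leaf = `gap_after`; weaker than the route's `SectorComplement`. -/
def SectorComplementAllWt : Prop := OddReciprocityQ allWt → _root_.Langlands

/-! ## §2 The floor member is a theorem (no sorry) -/

theorem oddReciprocityQ_regularWt_iff : OddReciprocityQ regularWt ↔ OddRegularReciprocityQ := Iff.rfl

/-- **FLOOR θ₀, PROVED**: the trichotomy at `ℓ`. -/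
theorem rung_regularWt : Rung regularWt := by
  intro k₁ k₂ h₃ h₄ ℓ _ ρ hirr hodd hunr hdR hcpt ι
  by_cases hℓ : ℓ = 2
  · by_cases hres : ρ.IsResiduallyAbsIrreducible
    · by_cases hsol : IsSolvable ρ.residualRep.range
      · exact k₂ ℓ hℓ ρ hres hsol hirr hodd hunr hdR hcpt ι
      · exact h₄ ℓ hℓ ρ hres hsol hirr hodd hunr hdR hcpt ι
    · exact k₁ ℓ hℓ ρ hres hirr hodd hunr hdR hcpt ι
  · exact h₃ ℓ hℓ ρ hirr hodd hunr hdR hcpt ι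

/-- The same floor from the LANDED theorem `Theorems.dyadicOddResidue_not_target_iff_sectors`
(`¬ X ↔ ¬ K1 ∨ ¬ K2 ∨ ¬ S1 ∨ ¬ S2`). -/
theorem rung_regularWt_of_landed : Rung regularWt := by
  intro k₁ k₂ h₃ h₄
  by_contra hX
  rcases (Summit.Langlands.Langlands.Theorems.dyadicOddResidue_not_target_iff_sectors.1 hX) with h | h | h | h <;>
    contradiction

/-- F3 line: the rung family specialises to the proved floor. -/
example : Rung regularWt := by simpa [Rung] using rung_regularWt_of_landed

/-- Informational: the floor also follows from any higher rung (antitone family). -/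
example (h : Rung oddPrimesAllWt) : Rung regularWt := by
  intro k₁ k₂ s₁ s₂ ℓ _ ρ hirr hodd hunr hdR hcpt ι
  exact h k₁ k₂ s₁ s₂ ℓ ρ hirr hodd hunr (fun v hv => ⟨(hdR v hv).1, fun τ hτ _ => (hdR v hv).2 τ hτ⟩) hcpt ι

end Summit.Langlands.Langlands.Cruxes.Assembly.OddPrimesAllWt

end
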